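import Mathlib
import HarnessLib
import Summits.HubbardSuperconductivity.HubbardSuperconductivity.Theses.JosephsonMirror
import Literature.MathematicalPhysics.QuantumLattice.DWaveSource

/-!
# Sketch — crux-ideate for `JosephsonMirror.JmCusp` (stmt-HubbardSuperconductivity-2228), ideator 2

First lemmas of two idea cards (statements only; they must ELABORATE, proofs are not claimed here):

* card `thermofield-double-purification` — `TfdRayleigh` (abstract W-matrix Rayleigh bound for the
  thermofield-double trial matrix `W = e^{-βA/2} P`), `TfdColdCoherenceAt` (transfer C⁺: cold
  imaginary-time d-wave pair coherence of ONE layer), `JmGainAt` (part (i) of the crux at (U,δ)).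
* card `sourced-envelope-zero-excess-bridge` — `envelopeExcess` (Danskin/envelope excess bound for
  sourced minimisers), `gainOfLowEnergyBridge` (pair bridge between εL²-near-ground states ⇒ gain),
  `LowEnergyPairBridgeAt` (transfer C⁺: zero-excess-density pair bridge).
-/

set_option linter.dupNamespace false
namespace Summit.HubbardSuperconductivity.HubbardSuperconductivity.Cruxes.JmCusp.Ideator2

open Matrix Literature.MathematicalPhysics.QuantumLattice
open scoped Kronecker ComplexOrder

/-! ## Card 1 — thermofield-double purification -/

/-- **TFD Rayleigh bound (abstract first lemma of card 1).** `A` Hermitian and block-diagonal for two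
disjoint coordinate blocks `P₁`, `P₂` (it commutes with both indicator diagonals), `D` arbitrary,
window `S` = two-layer vectors supported on same-block pairs. For the thermofield-double trial matrix
`W = e^{-βA/2}(Pj₁+Pj₂)` (PSD, supported on the window) Lieb's energy functional gives
`E(J) · tr(Π e^{-βA}) ≤ 2 tr(Π A e^{-βA}) − 2J · Re tr(Π e^{-βA/2} D Π e^{-βA/2} Dᴴ)`:
the interlayer pair coherence of the TFD state is the imaginary-time pair correlator of ONE layer at
separation β/2. -/
def TfdRayleigh : Prop :=
  ∀ (ι : Type) [Fintype ι] [DecidableEq ι] (A D : Matrix ι ι ℂ), A.IsHermitian →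
    ∀ (P₁ P₂ : ι → Prop) [DecidablePred P₁] [DecidablePred P₂], (∀ s, P₁ s → ¬ P₂ s) →
    ∀ (S : Submodule ℂ (ι × ι → ℂ)),
      (∀ ψ, ψ ∈ S ↔ ∀ p : ι × ι, ¬ ((P₁ p.1 ∧ P₁ p.2) ∨ (P₂ p.1 ∧ P₂ p.2)) → ψ p = 0) →
    (let Pj₁ : Matrix ι ι ℂ := Matrix.diagonal fun s => if P₁ s then 1 else 0
     let Pj₂ : Matrix ι ι ℂ := Matrix.diagonal fun s => if P₂ s then 1 else 0
     A * Pj₁ = Pj₁ * A → A * Pj₂ = Pj₂ * A →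
     ∀ (β J : ℝ),
      (let Pw : Matrix ι ι ℂ := Pj₁ + Pj₂
       let Hd : Matrix (ι × ι) (ι × ι) ℂ :=
         A ⊗ₖ (1 : Matrix ι ι ℂ) + (1 : Matrix ι ι ℂ) ⊗ₖ Aᵀ - (J : ℂ) • (D ⊗ₖ Dᴴᵀ + Dᴴ ⊗ₖ Dᵀ)
       Hd.minEnergyOn S * (Pw * A.gibbsWeight β).trace.re ≤
         2 * (Pw * A * A.gibbsWeight β).trace.re -
           2 * J * (Pw * A.gibbsWeight (β / 2) * D * Pw * A.gibbsWeight (β / 2) * Dᴴ).trace.re))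

/-- Part (i) of `JmCusp` at a FIXED witness `(U, δ)` with constants `(a, J₀)`: uniform linear Josephson
gain of the window double (body copied verbatim from the route decl). -/
def JmGainAt (U δ a J₀ : ℝ) : Prop :=
  ∀ J ∈ Set.Ioc (0:ℝ) J₀, ∃ L₀ : ℕ, ∀ (L : ℕ) [NeZero L], Even L → L₀ ≤ L → (let ι : Type := Finset (Literature.MathematicalPhysics.QuantumLattice.Orb (Literature.MathematicalPhysics.QuantumLattice.FermionTorus 2 L)); let N : ℕ := 2 * ⌊(1 - δ) * (L : ℝ) ^ 2 / 2⌋₊; let H : Matrix ι ι ℂ := Literature.MathematicalPhysics.QuantumLattice.hubbardTorus 2 L 1 U; let μ : ℝ := (H.minEnergyOn (Literature.MathematicalPhysics.QuantumLattice.szSector N 0) - H.minEnergyOn (Literature.MathematicalPhysics.QuantumLattice.szSector (N - 2) 0)) / 2; let A : Matrix ι ι ℂ := Literature.MathematicalPhysics.QuantumLattice.hubbardTorusWith 2 L 1 U μ; let D : Matrix ι ι ℂ := ((L : ℂ))⁻¹ • Literature.MathematicalPhysics.QuantumLattice.pairField Literature.MathematicalPhysics.QuantumLattice.dWaveFormFactor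 L; let Hd : ℝ → Matrix (ι × ι) (ι × ι) ℂ := fun J => Matrix.kroneckerMap (fun a b : ℂ => a * b) A 1 + Matrix.kroneckerMap (fun a b : ℂ => a * b) 1 (Matrix.transpose A) - (J : ℂ) • (Matrix.kroneckerMap (fun a b : ℂ => a * b) D (Matrix.transpose (Matrix.conjTranspose D)) + Matrix.kroneckerMap (fun a b : ℂ => a * b) (Matrix.conjTranspose D) (Matrix.transpose D)); let good : ι × ι → Prop := fun p => ((p.1.card = N ∧ p.2.card = N) ∨ (p.1.card = N - 2 ∧ p.2.card = N - 2)) ∧ (p.1.filter (fun o => (ofLex o).2 = 0)).card = (p.1.filter (fun o => (ofLex o).2 = 1)).card ∧ (p.2.filter (fun o => (ofLex o).2 = 0)).card = (p.2.filter (fun o => (ofLex o).2 = 1)).card; let S : Submodule ℂ (ι × ι → ℂ) := ⨅ (p : ι × ι) (_ : ¬ good p), LinearMap.ker (LinearMap.proj (R := ℂ) (φ := fun _ : ι × ι => ℂ) p); let E : ℝ → ℝ := fun J => (Hd J).minEnergyOn S; a * J * (L : ℝ) ^ 2 ≤ E 0 - E J)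

/-- **Transfer C⁺ of card 1 (cold imaginary-time pair coherence of ONE layer).** At `(U, δ)` there is a
cold schedule `β_L → ∞` along which the window Gibbs state of the balanced layer Hamiltonian
`A = H − μ_L N` (window = sectors `(N_L,0) ⊕ (N_L−2,0)`) has macroscopic d-wave pair coherence at
imaginary-time separation `β_L/2`:
`tr(Π e^{-β_L A/2} Δ_d Π e^{-β_L A/2} Δ_dᴴ) ≥ a·L⁴ · tr(Π e^{-β_L A})`. -/
def TfdColdCoherenceAt (U δ a : ℝ) : Prop :=
  ∃ β : ℕ → ℝ, Filter.Tendsto β Filter.atTop Filter.atTop ∧ ∃ L₀ : ℕ, ∀ (L : ℕ) [NeZero L], Even L → L₀ ≤ L →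
    (let ι : Type := Finset (Orb (FermionTorus 2 L))
     let N : ℕ := 2 * ⌊(1 - δ) * (L : ℝ) ^ 2 / 2⌋₊
     let H : Matrix ι ι ℂ := hubbardTorus 2 L 1 U
     let μ : ℝ := (H.minEnergyOn (szSector N 0) - H.minEnergyOn (szSector (N - 2) 0)) / 2
     let A : Matrix ι ι ℂ := hubbardTorusWith 2 L 1 U μ
     let Δ : Matrix ι ι ℂ := pairField dWaveFormFactor L
     let blk : ℕ → ι → Prop := fun n s =>
       s.card = n ∧ (s.filter (fun o => (ofLex o).2 = 0)).card = (s.filter (fun o => (ofLex o).2 = 1)).card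
     let Pw : Matrix ι ι ℂ := Matrix.diagonal fun s => if blk N s ∨ blk (N - 2) s then 1 else 0
     a * (L : ℝ) ^ 4 * (Pw * A.gibbsWeight (β L)).trace.re ≤
       (Pw * A.gibbsWeight (β L / 2) * Δ * Pw * A.gibbsWeight (β L / 2) * Δᴴ).trace.re)

/-- The line of card 1 (composition to be kernel-checked in crux-plan): cold imaginary-time coherence
⇒ uniform linear Josephson gain with the SAME constant up to a factor (entropy price
`2 log(dim)/β_L = O(L²/β_L) = o(L²)`). -/
def TfdLine : Prop :=
  ∀ U δ a : ℝ, 0 < U → δ ∈ Set.Ioo (0:ℝ) (1 / 2) → 0 < a →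
    TfdColdCoherenceAt U δ a → JmGainAt U δ a 1

/-! ## Card 2 — sourced envelope / zero-excess-density pair bridge -/

/-- **Envelope (Danskin) excess bound — first lemma of card 2.** For Hermitian `A`, Hermitian source
`Q`, `h ≥ 0`: any unit minimiser `φ` of `A − hQ` on an `A`- and `Q`-invariant sector `K` is a
LOW-EXCESS trial state for `A` itself,
`⟨φ, Aφ⟩ − min_K A ≤ h · (⟨φ, Qφ⟩ − ⟨ψ, Qψ⟩)` for EVERY unit minimiser `ψ` of `A` on `K` —
the excess is `h × (response at h − response at 0⁺)`, i.e. `o(h)` per site once the response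
saturates; no absolute knowledge of either energy is used. -/
def envelopeExcess : Prop :=
  ∀ (n : Type) [Fintype n] [DecidableEq n] (A Q : Matrix n n ℂ) (K : Submodule ℂ (n → ℂ)) (h : ℝ),
    A.IsHermitian → Q.IsHermitian → 0 ≤ h →
    ∀ φ ∈ K, star φ ⬝ᵥ φ = 1 →
      (star φ ⬝ᵥ (A - (h : ℂ) • Q) *ᵥ φ).re = (A - (h : ℂ) • Q).minEnergyOn K →
    ∀ ψ ∈ K, star ψ ⬝ᵥ ψ = 1 → (star ψ ⬝ᵥ A *ᵥ ψ).re = A.minEnergyOn K →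
      (star φ ⬝ᵥ A *ᵥ φ).re - A.minEnergyOn K ≤
        h * ((star φ ⬝ᵥ Q *ᵥ φ).re - (star ψ ⬝ᵥ Q *ᵥ ψ).re)

/-- **Low-energy pair bridge ⇒ Josephson gain (consuming lemma of card 2; the ground-state
hypotheses of `gain_le_minEnergyOn_sub` / support 2231 replaced by arbitrary unit block vectors,
paying their excesses).** -/
def gainOfLowEnergyBridge : Prop :=
  ∀ (ι : Type) [Fintype ι] [DecidableEq ι] (A D : Matrix ι ι ℂ), A.IsHermitian →
    ∀ (P₁ P₂ : ι → Prop), (∀ s, P₁ s → ¬ P₂ s) →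
    ∀ (good : ι × ι → Prop), (∀ s t, good (s, t) → (P₁ s ∧ P₁ t) ∨ (P₂ s ∧ P₂ t)) →
      (∀ s t, P₁ s → P₁ t → good (s, t)) → (∀ s t, P₂ s → P₂ t → good (s, t)) →
    ∀ (S : Submodule ℂ (ι × ι → ℂ)), (∀ ψ, ψ ∈ S ↔ ∀ p, ¬ good p → ψ p = 0) →
    ∀ (a : ℝ),
      (∀ v : ι → ℂ, (∀ s, ¬ P₁ s → v s = 0) → a * (star v ⬝ᵥ v).re ≤ (star v ⬝ᵥ A *ᵥ v).re) →
      (∀ v : ι → ℂ, (∀ s, ¬ P₂ s → v s = 0) → a * (star v ⬝ᵥ v).re ≤ (star v ⬝ᵥ A *ᵥ v).re) →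
    ∀ (φ χ : ι → ℂ), (∀ s, ¬ P₁ s → φ s = 0) → (∀ s, ¬ P₂ s → χ s = 0) →
      star φ ⬝ᵥ φ = 1 → star χ ⬝ᵥ χ = 1 →
    ∀ (J : ℝ), 0 ≤ J →
      J * ‖star χ ⬝ᵥ D *ᵥ φ‖ ^ 2 - ((star φ ⬝ᵥ A *ᵥ φ).re - a) - ((star χ ⬝ᵥ A *ᵥ χ).re - a) ≤
        (A ⊗ₖ (1 : Matrix ι ι ℂ) + (1 : Matrix ι ι ℂ) ⊗ₖ Aᵀ -
            ((0 : ℝ) : ℂ) • (D ⊗ₖ Dᴴᵀ + Dᴴ ⊗ₖ Dᵀ)).minEnergyOn S -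
          (A ⊗ₖ (1 : Matrix ι ι ℂ) + (1 : Matrix ι ι ℂ) ⊗ₖ Aᵀ -
            (J : ℂ) • (D ⊗ₖ Dᴴᵀ + Dᴴ ⊗ₖ Dᵀ)).minEnergyOn S

/-- **Transfer C⁺ of card 2 (zero-excess-density pair bridge, LEPB).** At `(U, δ)`: for every energy
DENSITY tolerance `ε > 0`, eventually in even `L`, some unit `φ ∈ (N_L, 0)`, `χ ∈ (N_L − 2, 0)` within
`εL²` of their sector ground energies are Δ_d-connected at order `L⁴`. -/
def LowEnergyPairBridgeAt (U δ a : ℝ) : Prop :=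
  ∀ ε : ℝ, 0 < ε → ∃ L₀ : ℕ, ∀ (L : ℕ) [NeZero L], Even L → L₀ ≤ L →
    (let ι : Type := Finset (Orb (FermionTorus 2 L))
     let N : ℕ := 2 * ⌊(1 - δ) * (L : ℝ) ^ 2 / 2⌋₊
     let H : Matrix ι ι ℂ := hubbardTorus 2 L 1 U
     ∃ φ χ : ι → ℂ, φ ∈ szSector N 0 ∧ star φ ⬝ᵥ φ = 1 ∧ χ ∈ szSector (N - 2) 0 ∧ star χ ⬝ᵥ χ = 1 ∧
       (star φ ⬝ᵥ H *ᵥ φ).re ≤ H.minEnergyOn (szSector N 0) + ε * (L : ℝ) ^ 2 ∧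
       (star χ ⬝ᵥ H *ᵥ χ).re ≤ H.minEnergyOn (szSector (N - 2) 0) + ε * (L : ℝ) ^ 2 ∧
       a * (L : ℝ) ^ 4 ≤ ‖star χ ⬝ᵥ (pairField dWaveFormFactor L) *ᵥ φ‖ ^ 2)

/-- The line of card 2: LEPB ⇒ uniform linear gain with half the constant (take `ε := aJ/4`). -/
def LepbLine : Prop :=
  ∀ U δ a : ℝ, 0 < U → δ ∈ Set.Ioo (0:ℝ) (1 / 2) → 0 < a →
    LowEnergyPairBridgeAt U δ a → JmGainAt U δ (a / 2) 1

/-- The engine-facing reduction of card 2: quasi-average d-wave SSB in the Koma–Tasaki sense at some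
chemical potential whose density window meets `1 − δ` (tree notion `HasDWaveOrder`), plus number
projection of sourced minimisers (informal stub), should give LEPB. Stated as the shape of the claim. -/
def SsbGivesLepb : Prop :=
  ∀ U δ : ℝ, 0 < U → δ ∈ Set.Ioo (0:ℝ) (1 / 2) →
    (∃ μ : ℝ, HasDWaveOrder U μ) → ∃ a : ℝ, 0 < a ∧ LowEnergyPairBridgeAt U δ a

end Summit.HubbardSuperconductivity.HubbardSuperconductivity.Cruxes.JmCusp.Ideator2
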